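import Summits.RiemannHypothesis.RiemannHypothesis.Theorems.ThetaTier2RowData
import Summits.RiemannHypothesis.RiemannHypothesis.Theorems.WeilColumnThetaUCT2Valid
import Summits.RiemannHypothesis.RiemannHypothesis.Theorems.WeilColumnBSplineIrwinHallBridge
import Summits.RiemannHypothesis.RiemannHypothesis.Theorems.ThetaTier1Bridge
import HarnessLib

/-!
# THETA tier-2 — the BRIDGE from a certified row `Row2` to the analytic interface `ThetaParams`, part 1: identities (RH-FREE)

WEIL column (LADDER-RH, W-P(P2); route `WeilSemilocal`, item 19172; cc-s2-1 gen23 `ThetaTier2Row`/`RowSound`/`RowData` (`Row2`, `Row2.real`,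
`check_sound : r.check = true → T2Valid r.inp r.real ∧ RowFacts r`) and this seat's `WeilColumnThetaUCT2Valid` (`T2Matches`, `ucT2_of_valid`).
The analytic parameters of a row are `ofRow2 r := ⟨q, m, δ, η′, c₁, m₀, c₂⟩`; this file proves the closed-form IDENTITIES between the
`ThetaParams` quantities of `ofRow2 r` and the fields of `r.real` (`u₁ = e^{η′−δ}/√q`, `ζ⋆ = r.zsR`, `θ₀ = r.th0R`, `M₀ = r.M0R`, `M₁₀ = r.M10R`,
`M = M₀ζ(m+1) ≤ Mb`, `M₁ ≤ Mb1`, `−2x₁ = log q + 2δ − 2η′`, `χ_L = IH`, `Rtop = IH`, the cut values and `Jexplicit(2^{-k}) = JR`), in the pattern of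
tier 1's `ThetaTier1Bridge`. Part 2 (`ThetaTier2BridgeMatches`) assembles `T2Matches (ofRow2 r) r.inp r.real`, admissibility and UC(q).
Nothing here bears on the truth of RH.
-/

set_option linter.dupNamespace false
set_option autoImplicit false

namespace Summit.RiemannHypothesis.RiemannHypothesis.Theorems.ThetaTier2

open Summit.RiemannHypothesis.RiemannHypothesis.Theorems.WeilColumn.ThetaMellin
open ThetaTier1 (IH zetaHi pLamHi GAMMA_LO ZetaHyp LambdaHyp)
open Finset

noncomputable section

/-- The analytic parameters of a tier-2 row: `⟨q, m, δ, η′, c₁, m₀, c₂⟩`. [this seat; TIER2-KERNEL-SPEC §4] -/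
def ofRow2 (r : Row2) : ThetaParams := ⟨r.q, r.m, (r.delta : ℝ), (r.eta : ℝ), (r.c1 : ℝ), (r.m0 : ℝ), (r.c2 : ℝ)⟩

namespace Row2

variable (r : Row2)

/-- `ofRow2_q`. [bookkeeping] -/
@[simp] theorem ofRow2_q : (ofRow2 r).q = r.q := rfl
/-- `ofRow2_m`. [bookkeeping] -/
@[simp] theorem ofRow2_m : (ofRow2 r).m = r.m := rfl
/-- `ofRow2_δ`. [bookkeeping] -/
@[simp] theorem ofRow2_δ : (ofRow2 r).δ = (r.delta : ℝ) := rfl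
/-- `ofRow2_η`. [bookkeeping] -/
@[simp] theorem ofRow2_η : (ofRow2 r).η = (r.eta : ℝ) := rfl
/-- `ofRow2_c₁`. [bookkeeping] -/
@[simp] theorem ofRow2_c₁ : (ofRow2 r).c₁ = (r.c1 : ℝ) := rfl
/-- `ofRow2_m₀`. [bookkeeping] -/
@[simp] theorem ofRow2_m₀ : (ofRow2 r).m₀ = (r.m0 : ℝ) := rfl
/-- `ofRow2_c₂`. [bookkeeping] -/
@[simp] theorem ofRow2_c₂ : (ofRow2 r).c₂ = (r.c2 : ℝ) := rfl

/-- `c₂ = 1`. [bookkeeping] -/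
theorem c2_eq_one : r.c2 = 1 := rfl

variable {r}

/-- `q_pos`. [bookkeeping] -/
theorem q_pos_real (hq : 2 ≤ r.q) : (0 : ℝ) < r.q := by exact_mod_cast (by omega : 0 < r.q)

/-- `ε = r.eps`. [bookkeeping] -/
theorem eps_eq : (ofRow2 r).ε = ((r.eps : ℚ) : ℝ) := by
  simp only [ThetaParams.ε, ofRow2_δ, ofRow2_c₂, Row2.eps]; push_cast; ring

/-- `α = r.alpha`. [bookkeeping] -/
theorem alpha_eq : (ofRow2 r).α = ((r.alpha : ℚ) : ℝ) := by
  simp only [ThetaParams.α, eps_eq, ofRow2_c₂, ofRow2_m₀, ofRow2_c₁, Row2.alpha]; push_cast; ring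

/-- `Σ|c| = r.csum`. [bookkeeping] -/
theorem csum_eq : (ofRow2 r).csum = ((r.csum : ℚ) : ℝ) := by
  simp only [ThetaParams.csum, alpha_eq, Row2.csum]; push_cast; ring

/-- `h_max = r.hmax`. [bookkeeping] -/
theorem hmax_eq : (ofRow2 r).hmax = ((r.hmax : ℚ) : ℝ) := by
  simp only [ThetaParams.hmax, alpha_eq, Row2.hmax]; push_cast; rfl

/-- `e^{a} = √q·e^{δ}`. [bookkeeping] -/
theorem exp_a (hq : 2 ≤ r.q) : Real.exp (ofRow2 r).a = Real.sqrt r.q * Real.exp r.delta := by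
  have h0 : (0 : ℝ) ≤ r.q := (q_pos_real hq).le
  simp only [ThetaParams.a, ofRow2_q, ofRow2_δ]
  rw [Real.exp_add, ← Real.log_sqrt h0, Real.exp_log (Real.sqrt_pos.2 (q_pos_real hq))]

/-- **`u₁ = e^{η′−δ}/√q = r.real.u₁`.** [TIER2-KERNEL-SPEC §1] -/
theorem u1_eq (hq : 2 ≤ r.q) : (ofRow2 r).u₁ = Real.exp ((r.eta - r.delta : ℚ) : ℝ) * (Real.sqrt r.q)⁻¹ := by
  have hs := Real.sqrt_pos.2 (q_pos_real hq)
  simp only [ThetaParams.u₁, ThetaParams.x₁, ofRow2_η]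
  rw [Real.exp_sub, exp_a hq]
  push_cast
  rw [Real.exp_sub]
  field_simp

/-- **`ζ⋆ = 4πδq·e^{2δ−η′} = r.zsR`.** [TIER2-KERNEL-SPEC §1] -/
theorem zstar_eq (hq : 2 ≤ r.q) : (ofRow2 r).zstar = r.zsR := by
  have hs := Real.sqrt_pos.2 (q_pos_real hq)
  simp only [ThetaParams.zstar, ThetaParams.lam, ThetaParams.u₁, ThetaParams.x₁, ThetaParams.ε, ofRow2_c₂, ofRow2_η, ofRow2_δ,
    Row2.zsR, c2_eq_one, Rat.cast_one, mul_one, div_one]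
  rw [Real.exp_sub, exp_a hq]
  have e2 : (((2 * r.delta - r.eta : ℚ)) : ℝ) = 2 * (r.delta : ℝ) - r.eta := by push_cast; ring
  rw [e2, Real.exp_sub, show (2 : ℝ) * r.delta = r.delta + r.delta by ring, Real.exp_add]
  have he : Real.exp (r.eta : ℝ) ≠ 0 := (Real.exp_pos _).ne'
  set sq := Real.sqrt r.q with hsq
  have hq' : (r.q : ℝ) = sq ^ 2 := by rw [hsq, Real.sq_sqrt (q_pos_real hq).le]
  rw [hq']
  field_simp
  ring

/-- `0 < ζ⋆`. [bookkeeping] -/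
theorem zstar_pos (hq : 2 ≤ r.q) (hd : 0 < r.delta) : 0 < (ofRow2 r).zstar := by
  rw [zstar_eq hq]; exact r.zsR_pos hq hd

/-- **`θ₀ = r.th0R`.** [E1; TIER2-KERNEL-SPEC §1] -/
theorem θ₀_eq (hq : 2 ≤ r.q) : (ofRow2 r).θ₀ = r.th0R := by
  simp only [ThetaParams.θ₀, zstar_eq hq, ofRow2_m, Row2.th0R]; ring

/-- `(m/ζ⋆)^m = r.ratMR`. [bookkeeping] -/
theorem ratM_eq (hq : 2 ≤ r.q) : (((ofRow2 r).m : ℝ) / (ofRow2 r).zstar) ^ (ofRow2 r).m = r.ratMR := by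
  simp only [zstar_eq hq, ofRow2_m, Row2.ratMR, div_eq_mul_inv]

/-- **`M₀ = r.M0R`.** [E1; TIER2-KERNEL-SPEC §1] -/
theorem M₀_eq (hq : 2 ≤ r.q) : (ofRow2 r).M₀ = r.M0R := by
  simp only [ThetaParams.M₀, ← ratM_eq hq, csum_eq, Row2.M0R, div_eq_mul_inv]

/-- `λ/u₁ = q·e^{2δ−η′}/c₂`. [bookkeeping] -/
theorem lam_div_u1 (hq : 2 ≤ r.q) : (ofRow2 r).lam / (ofRow2 r).u₁ = r.q * Real.exp ((2 * r.delta - r.eta : ℚ) : ℝ) := by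
  simp only [ThetaParams.lam, ThetaParams.u₁, ThetaParams.x₁, ofRow2_c₂, ofRow2_η, c2_eq_one, Rat.cast_one, div_one]
  have e2 : (((2 * r.delta - r.eta : ℚ)) : ℝ) = 2 * (r.delta : ℝ) - r.eta := by push_cast; ring
  rw [e2, div_eq_iff (Real.exp_pos _).ne', ← Real.exp_log (q_pos_real hq), ← Real.exp_add, ← Real.exp_add]
  congr 1
  simp only [ThetaParams.a, ofRow2_q, ofRow2_δ]
  ring

/-- **`M₁₀ = r.M10R`.** [E1; TIER2-KERNEL-SPEC §1] -/
theorem M₁₀_eq (hq : 2 ≤ r.q) : (ofRow2 r).M₁₀ = r.M10R := by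
  simp only [ThetaParams.M₁₀, lam_div_u1 hq, ← ratM_eq hq, csum_eq, Row2.M10R, c2_eq_one]
  push_cast
  ring

/-- `0 ≤ ζ-tail`. [bookkeeping] -/
theorem zetaTail_nonneg (s : ℕ) : 0 ≤ ThetaParams.zetaTail s := tsum_nonneg fun n ↦ by positivity

/-- `0 < M₀` on a good row. [bookkeeping] -/
theorem M0R_pos (hq : 2 ≤ r.q) (hm : 1 ≤ r.m) (hd : 0 < r.delta) (hcs : 0 < r.csum) : 0 < r.M0R := by
  have hz := r.zsR_pos hq hd
  have hm' : (0 : ℝ) < r.m := by exact_mod_cast hm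
  unfold M0R ratMR
  have : (0 : ℝ) < r.csum := by exact_mod_cast hcs
  positivity

/-- **`M = M₀·ζ(m+1) ≤ r.real.Mb`** (ζ stand-in). [D1; TIER2-KERNEL-SPEC §1] -/
theorem M_le (hq : 2 ≤ r.q) (hm : 1 ≤ r.m) (hd : 0 < r.delta) (hcs : 0 < r.csum) (hZ : ZetaHyp r.m) :
    0 ≤ (ofRow2 r).M ∧ (ofRow2 r).M ≤ r.M0R * (zetaHi (r.m + 1) : ℝ) := by
  rw [(ofRow2 r).M_eq_M₀_mul_zetaTail, M₀_eq hq, ofRow2_m]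
  have h0 := (M0R_pos hq hm hd hcs).le
  exact ⟨mul_nonneg h0 (zetaTail_nonneg _), mul_le_mul_of_nonneg_left hZ.1 h0⟩

/-- **`M₁ = M₁₀·(c₂ + ε(1 + θ₀⁻¹))·ζ(m) ≤ r.real.Mb1`.** [D2; TIER2-KERNEL-SPEC §1] -/
theorem M1_le (hq : 2 ≤ r.q) (hd : 0 < r.delta) (hZ : ZetaHyp r.m) (hcs : 0 ≤ r.csum) :
    0 ≤ (ofRow2 r).M₁ ∧ (ofRow2 r).M₁ ≤ r.M10R * ((zetaHi r.m : ℝ) * ((r.c2 : ℝ) + (r.eps : ℝ) * (1 + r.th0R⁻¹))) := by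
  have hz := zstar_pos hq hd
  have hθinv : (ofRow2 r).θ₀⁻¹ = (ofRow2 r).m / (ofRow2 r).zstar := by simp only [ThetaParams.θ₀, inv_div]
  have eM1 : (ofRow2 r).M₁ = (ofRow2 r).M₁₀ * ((((r.c2 : ℚ) : ℝ) + ((r.eps : ℚ) : ℝ) * (1 + (ofRow2 r).θ₀⁻¹)) *
      ThetaParams.zetaTail r.m) := by
    rw [hθinv]
    simp only [ThetaParams.M₁, ThetaParams.M₁₀, eps_eq, ofRow2_c₂, ofRow2_m]
    ring
  rw [θ₀_eq hq, M₁₀_eq hq] at eM1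
  have hM10 : 0 ≤ r.M10R := by
    unfold M10R ratMR
    have : (0 : ℝ) ≤ ((2 * r.q * r.csum / r.c2 : ℚ) : ℝ) := by
      have h' : (0 : ℚ) ≤ 2 * r.q * r.csum / r.c2 := by rw [c2_eq_one]; positivity
      exact_mod_cast h'
    have hz' := (r.zsR_pos hq hd).le
    positivity
  have hθ0 : 0 ≤ r.th0R := by
    rw [← θ₀_eq hq]; unfold ThetaParams.θ₀; exact div_nonneg hz.le (Nat.cast_nonneg _)
  have he : (0 : ℝ) ≤ ((r.eps : ℚ) : ℝ) := by
    have h' : (0 : ℚ) ≤ r.eps := by unfold Row2.eps; rw [c2_eq_one]; positivity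
    exact_mod_cast h'
  have hc2 : ((r.c2 : ℚ) : ℝ) = 1 := by rw [c2_eq_one, Rat.cast_one]
  have hfac : 0 ≤ ((r.c2 : ℚ) : ℝ) + ((r.eps : ℚ) : ℝ) * (1 + r.th0R⁻¹) := by rw [hc2]; positivity
  rw [eM1]
  refine ⟨mul_nonneg hM10 (mul_nonneg hfac (zetaTail_nonneg _)), mul_le_mul_of_nonneg_left ?_ hM10⟩
  calc (((r.c2 : ℚ) : ℝ) + ((r.eps : ℚ) : ℝ) * (1 + r.th0R⁻¹)) * ThetaParams.zetaTail r.m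
      ≤ (((r.c2 : ℚ) : ℝ) + ((r.eps : ℚ) : ℝ) * (1 + r.th0R⁻¹)) * (zetaHi r.m : ℝ) := mul_le_mul_of_nonneg_left hZ.2 hfac
    _ = (zetaHi r.m : ℝ) * ((r.c2 : ℝ) + (r.eps : ℝ) * (1 + r.th0R⁻¹)) := mul_comm _ _

/-- **`−2x₁ = log q + (2δ − 2η′)`.** [bookkeeping; TIER2-KERNEL-SPEC §4 (`log N`)] -/
theorem neg_two_x₁ : -2 * (ofRow2 r).x₁ = Real.log r.q + ((2 * r.delta - 2 * r.eta : ℚ) : ℝ) := by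
  simp only [ThetaParams.x₁, ThetaParams.a, ofRow2_q, ofRow2_δ, ofRow2_η]; push_cast; ring

/-- `√(e^{−2x₁}) = √q·e^{δ−η′}`. [bookkeeping] -/
theorem sqrt_N_eq (hq : 2 ≤ r.q) : Real.sqrt (Real.exp (-2 * (ofRow2 r).x₁)) = Real.sqrt r.q * Real.exp ((r.delta - r.eta : ℚ) : ℝ) := by
  rw [(ofRow2 r).sqrt_exp_neg_two_x₁, u1_eq hq, mul_inv, inv_inv, ← Real.exp_neg]
  push_cast
  rw [show -((r.eta : ℝ) - r.delta) = r.delta - r.eta by ring]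
  ring

/-- **The Chebyshev constant of the row**: `log 4 + 2·log N/√N = r.real.C`, `N = e^{−2x₁}`. [TIER2-KERNEL-SPEC §1 (`Cpsi`)] -/
theorem chebConst_eq (hq : 2 ≤ r.q) :
    Real.log 4 + 2 * (Real.log (Real.exp (-2 * (ofRow2 r).x₁)) / Real.sqrt (Real.exp (-2 * (ofRow2 r).x₁))) = r.real.C := by
  have hs := Real.sqrt_pos.2 (q_pos_real hq)
  rw [Real.log_exp, sqrt_N_eq hq, neg_two_x₁, show (4 : ℝ) = 2 ^ 2 by norm_num, Real.log_pow]
  show _ = 2 * Real.log 2 + 2 * (Real.log r.q + ((2 * r.delta - 2 * r.eta : ℚ) : ℝ)) * Real.exp ((r.eta - r.delta : ℚ) : ℝ)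
    * (Real.sqrt r.q)⁻¹
  have he : Real.exp ((r.delta - r.eta : ℚ) : ℝ) = (Real.exp ((r.eta - r.delta : ℚ) : ℝ))⁻¹ := by
    rw [← Real.exp_neg]; push_cast; ring_nf
  rw [he]
  push_cast
  field_simp

/-- **`χ_L = IH m (2mδ/η′) = r.chiL`.** [D4; TIER2-KERNEL-SPEC §1] -/
theorem chiL_eq (hm : 1 ≤ r.m) : (ofRow2 r).chiL = ((r.chiL : ℚ) : ℝ) := by
  rw [(ofRow2 r).chiL_eq_IH (show 1 ≤ (ofRow2 r).m from hm) (d := r.delta) (e := r.eta) rfl rfl r.eta_pos]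
  rfl

/-! ## The arch coefficient, the gain profile, the cut values, the kernel input's data fields -/

/-- **`Jexplicit (2^{-k}) = r.JR`.** [D7; TIER2-KERNEL-SPEC §1 (`coefA`)] -/
theorem Jexplicit_eq_JR : ThetaParams.Jexplicit (((r.t0 : ℚ) : ℝ)) = r.JR := by
  have ht : (((r.t0 : ℚ)) : ℝ) = 1 / 2 ^ r.k := by unfold Row2.t0; push_cast; ring
  have hl : Real.log (1 / (1 / (2 : ℝ) ^ r.k)) = r.k * Real.log 2 := by rw [one_div_one_div, Real.log_pow]
  rw [ht]
  simp only [ThetaParams.Jexplicit, hl, Row2.JR]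
  have hne : (1 : ℝ) - Real.exp (-2) ≠ 0 := by
    have : Real.exp (-2) < 1 := Real.exp_lt_one_iff.2 (by norm_num)
    linarith
  push_cast
  field_simp
  ring

/-- **The arch coefficient is enclosed**: `max 0 (2·Jexplicit t₀ − log 4π − γ − C₁) ≤ r.real.cA` (`γ ≥ 1/2 = GAMMA_LO`). [D7] -/
theorem archCoef_le : max 0 (2 * ThetaParams.Jexplicit (((r.t0 : ℚ) : ℝ)) - Real.log (4 * Real.pi) - Real.eulerMascheroniConstant -
    ThetaParams.archC₁) ≤ r.real.cA := by
  show _ ≤ max 0 (2 * r.JR - Real.log (4 * Real.pi) - (GAMMA_LO : ℝ) - (Real.pi * (1 / 2) + Real.log 2))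
  rw [Jexplicit_eq_JR]
  refine max_le_max le_rfl ?_
  have hγ := Real.one_half_lt_eulerMascheroniConstant
  simp only [ThetaParams.archC₁, GAMMA_LO]
  push_cast
  linarith

/-- **The gain profile values are the analytic `R(τ₁…)`**: `r.gainA j = Rtop(((δj/J) − (δj/J)²/2)/(2δ))`, `J = 64`. [D8] -/
theorem gainA_eq (hm : 1 ≤ r.m) (j : ℕ) : ((r.gainA j : ℚ) : ℝ) =
    (ofRow2 r).Rtop ((((r.delta : ℝ) * j / 64) - ((r.delta : ℝ) * j / 64) ^ 2 / 2) / (2 * (r.delta : ℝ))) := by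
  have h := (ofRow2 r).Rtop_eq_IH (show 1 ≤ (ofRow2 r).m from hm) (r.tau1lo (r.delta * j / JG))
  simp only [ofRow2_m] at h
  unfold Row2.gainA
  rw [← h]
  congr 1
  unfold Row2.tau1lo JG
  push_cast
  ring

/-- `r.gainB j = Rtop(((2δ − δ(j+1)/J) − (…)²/2)/(2δ))`, `J = 64`. [D8] -/
theorem gainB_eq (hm : 1 ≤ r.m) (j : ℕ) : ((r.gainB j : ℚ) : ℝ) =
    (ofRow2 r).Rtop (((2 * (r.delta : ℝ) - (r.delta : ℝ) * (j + 1) / 64) -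
      (2 * (r.delta : ℝ) - (r.delta : ℝ) * (j + 1) / 64) ^ 2 / 2) / (2 * (r.delta : ℝ))) := by
  have h := (ofRow2 r).Rtop_eq_IH (show 1 ≤ (ofRow2 r).m from hm) (r.tau1lo (2 * r.delta - r.delta * (j + 1) / JG))
  simp only [ofRow2_m] at h
  unfold Row2.gainB
  rw [← h]
  congr 1
  unfold Row2.tau1lo JG
  push_cast
  ring

/-- **The cut value of cell `j` dominates `irwinHall m (m(j+1)τ/η′)`** (`= 1 − χ(x₁ − (j+1)τ)`). [TIER2-KERNEL-SPEC §1 (`cList`)] -/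
theorem irwinHall_le_cb (hm : 1 ≤ r.m) (j : ℕ) :
    irwinHall (ofRow2 r).m ((ofRow2 r).m * (((j : ℝ) + 1) * (TAU : ℝ)) / (ofRow2 r).η) ≤ r.real.cb j := by
  have hη : 0 < (ofRow2 r).η := by simp only [ofRow2_η]; exact_mod_cast r.eta_pos
  have hle1 : irwinHall (ofRow2 r).m ((ofRow2 r).m * (((j : ℝ) + 1) * (TAU : ℝ)) / (ofRow2 r).η) ≤ 1 := by
    rw [← (ofRow2 r).one_sub_cut_depth_eq_irwinHall hη hm]
    linarith [((ofRow2 r).cut_mem_Icc hη hm ((ofRow2 r).x₁ - ((j : ℝ) + 1) * (TAU : ℝ))).1]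
  show _ ≤ (if j < r.ncut then ((r.cutVal j : ℚ) : ℝ) else 1)
  split_ifs with hj
  · unfold Row2.cutVal
    split_ifs with h2
    · simpa using hle1
    · rw [ofRow2_m, ofRow2_η, ← irwinHall_eq_IH hm]
      push_cast
      exact le_rfl
  · exact hle1

end Row2

end

end Summit.RiemannHypothesis.RiemannHypothesis.Theorems.ThetaTier2
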